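import Literature.AlgebraicGeometry.Resolution.DecompletionZoom
import Literature.AlgebraicGeometry.Resolution.ValuationRingOpenInNormalizationProofs
import HarnessLib

/-!
# Temkin's decompletion lemma, algebraic proof — V. The zoom rings and linear smallness

Topic: `Literature/AlgebraicGeometry/Resolution`. M. Temkin, *Inseparable local uniformization*,
J. Algebra 373 (2013) 65–119 = arXiv:0804.1554v3, Lemma 3.3.2 (tree: `Temkin2013_Lemma332_nft`):
"we claim that `X′ = Nr(Spec(A[f/π]))` is as required. Obviously, `X′_η →~ X_η`. … the image of
`A[f/π]` is contained in `m°`, and we obtain that `i` lifts to `i′ : S_m → X′`" (p. 46). For a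
`DecompChart` `C` and a zoom level `j` this file constructs the algebraic version and its
basic estimates:

* `C.u j`, `C.Cj j`, `C.Aj j` — the zoom coordinates `uᵢ = τᵢ/πʲ`, the model `C_j = A₀[u]` and
  its normalization `A′_j = Nr_K(C_j)`; `A ≤ A′_j ≤ k[A]` (`X′ → X` a modification with
  `X′_η = X_η`), `isAffineNormalizedModel_Aj`, and VALUES IN `m°`: `ev_mem_O_of_mem_Aj` (`i`
  lifts to `i′`) — PROVED.
* `(α)` `C.s_mem_Aj` — the unit of the zoom is integral over the zoom model (`s² - s` is
  `π`-adically small there), `s_mul_h_mem_Aj`; the localization `C.A''₀ hj = A′_j[1/(s·sh)]`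
  (a neighbourhood of the centre of `m°`) in which `s`, `h`, `s₀` are units — PROVED.
* `C.exists_small` — LINEAR SMALLNESS: a function `g ∈ Rh` vanishing at the point satisfies
  `π^b g = π^j γ` with `γ ∈ A″₀_j` and `b` independent of `j` (finite-level form of
  "`|g| ≤ const·|π|^j` on the polydisc of radius `|π|^j`") — PROVED.
* `C.exists_mul_eq_pow_mul_unit` — INVERSION UP TO `π`: for `a ∈ k[A]` with `a(x) ≠ 0`,
  `a·r = π^N·t` with `t` of unit value in every deep zoom ring — PROVED.
* `evRingHom` — value at the point as a ring map `S → m°` — PROVED glue.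

All statements are [folklore]; no named facts.

## Sources

* M. Temkin, arXiv:0804.1554v3, proof of Lemma 3.3.2 (pp. 45–46).
-/

noncomputable section

open Polynomial

namespace Literature.AlgebraicGeometry.Resolution

universe u

variable {k K m : Type u} [Field k] [Field K] [Algebra k K] [Field m] [Algebra k m]

/-! ### The zoom rings `C_j ⊆ A′_j` -/

namespace DecompChart

variable {V : ValuationSubring k} {O : ValuationSubring m} {A : Subring K}
  {φ : Algebra.adjoin k (A : Set K) →ₐ[k] m} (C : DecompChart V O A φ)

/-- **The zoom coordinates** `uᵢ = τᵢ / πʲ` ("`T/π`" of Temkin's `X′ = Nr(Spec A[f/π])`, here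
with the explicit parameters `τ` of the point and a zoom level `j`). [folklore] -/
def u (j : ℕ) (i : Fin C.n) : K := C.τ i / C.πK ^ j

/-- `τᵢ = πʲ uᵢ`. [folklore] -/
theorem τ_eq_pow_mul_u (j : ℕ) (i : Fin C.n) : C.τ i = C.πK ^ j * C.u j i := by
  rw [u, mul_div_cancel₀ _ (pow_ne_zero j C.πK_ne_zero)]

/-- **The `j`-th zoom model** `C_j = A₀[u] = k°[f, τ/πʲ] ⊆ K` (Temkin's `A[f/π]`). [folklore] -/
def Cj (j : ℕ) : Subring K := Subring.closure ((C.A₀ : Set K) ∪ Set.range (C.u j))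

/-- `A₀ ≤ C_j`. [folklore] -/
theorem A₀_le_Cj (j : ℕ) : C.A₀ ≤ C.Cj j := fun _ hz =>
  Subring.subset_closure (Set.mem_union_left _ hz)

/-- `uᵢ ∈ C_j`. [folklore] -/
theorem u_mem_Cj (j : ℕ) (i : Fin C.n) : C.u j i ∈ C.Cj j :=
  Subring.subset_closure (Set.mem_union_right _ ⟨i, rfl⟩)

/-- `π ∈ C_j`. [folklore] -/
theorem πK_mem_Cj (j : ℕ) : C.πK ∈ C.Cj j := C.A₀_le_Cj j C.πK_mem_A₀

/-- `uᵢ ∈ R`. [folklore] -/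
theorem u_mem_R (j : ℕ) (i : Fin C.n) : C.u j i ∈ Algebra.adjoin k (A : Set K) := by
  rw [u, div_eq_mul_inv, ← inv_pow, πK, ← map_inv₀]
  exact Subalgebra.mul_mem _ (Algebra.subset_adjoin (C.A₀_le_A (C.τ_mem_A₀ i)))
    (Subalgebra.pow_mem _ (Subalgebra.algebraMap_mem _ _) _)

/-- `C_j ≤ R`. [folklore] -/
theorem Cj_le_R (j : ℕ) : C.Cj j ≤ (Algebra.adjoin k (A : Set K)).toSubring := by
  refine Subring.closure_le.mpr (Set.union_subset ?_ ?_)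
  · exact fun z hz => Algebra.subset_adjoin (C.A₀_le_A hz)
  · rintro _ ⟨i, rfl⟩; exact C.u_mem_R j i

/-- `C_j ≤ Rh`. [folklore] -/
theorem Cj_subset_Rh (j : ℕ) {z : K} (hz : z ∈ C.Cj j) : z ∈ C.Rh := C.R_le_Rh (C.Cj_le_R j hz)

/-- `C_j ≤ Rx`. [folklore] -/
theorem Cj_subset_Rx (j : ℕ) {z : K} (hz : z ∈ C.Cj j) : z ∈ (Rx φ) := R_le_Rx φ (C.Cj_le_R j hz)

/-- **The `j`-th normalized zoom model** `A′_j = Nr_K(C_j)` (Temkin's `X′ = Nr(Spec A[f/π])`).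
[folklore] -/
def Aj (j : ℕ) : Subring K := nrIn (C.Cj j)

/-- Membership in `A′_j` is integrality over `C_j`. [folklore] -/
theorem mem_Aj_iff (j : ℕ) (z : K) : z ∈ C.Aj j ↔ IsIntegral (C.Cj j) z := Iff.rfl

/-- `C_j ≤ A′_j`. [folklore] -/
theorem Cj_le_Aj (j : ℕ) : C.Cj j ≤ C.Aj j := le_nrIn _

/-- `A = Nr_K(A₀)`. [folklore] -/
theorem A_eq_nrIn : A = nrIn C.A₀ := by
  haveI := C
  exact SetLike.ext fun z => C.mem_A_iff z

/-- `A ≤ A′_j` (`X′ → X` is a modification). [folklore] -/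
theorem A_le_Aj (j : ℕ) : A ≤ C.Aj j := fun z hz =>
  nrIn_mono (C.A₀_le_Cj j) (show z ∈ nrIn C.A₀ from (C.mem_A_iff z).mp hz)

include C in
/-- `R = k[A]` is integrally closed in `K` (a localization of the integrally closed `A`).
[folklore] -/
theorem mem_R_of_isIntegral {z : K} (hz : IsIntegral (Algebra.adjoin k (A : Set K)) z) :
    z ∈ Algebra.adjoin k (A : Set K) := by
  have hB : ∀ c : k, ∃ a ∈ V.toSubring, ∃ b ∈ V.toSubring, c = a / b := fun c => by
    rcases V.mem_or_inv_mem c with hc | hc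
    · exact ⟨c, hc, 1, V.one_mem, by simp⟩
    · by_cases hc0 : c = 0
      · exact ⟨0, V.zero_mem, 1, V.one_mem, by simp [hc0]⟩
      · exact ⟨1, V.one_mem, c⁻¹, hc, by field_simp⟩
  have hVA : baseRing K V ≤ A := fun z hz => C.A₀_le_A (C.baseRing_le_A₀ hz)
  refine mem_adjoin_of_isIntegral_adjoin V.toSubring hB A hVA (fun x hx => ?_) hz
  -- `A` is integrally closed in `K`
  have : x ∈ nrIn A := hx
  rwa [C.A_eq_nrIn, nrIn_nrIn, ← C.A_eq_nrIn] at this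

/-- `A′_j ≤ R` (`X′_η = X_η`). [folklore] -/
theorem Aj_le_R (j : ℕ) : C.Aj j ≤ (Algebra.adjoin k (A : Set K)).toSubring := by
  intro z hz
  apply C.mem_R_of_isIntegral
  letI : Algebra (C.Cj j) (Algebra.adjoin k (A : Set K)) :=
    (Subring.inclusion (C.Cj_le_R j)).toAlgebra
  haveI : IsScalarTower (C.Cj j) (Algebra.adjoin k (A : Set K)) K :=
    IsScalarTower.of_algebraMap_eq (fun _ => rfl)
  exact ((C.mem_Aj_iff j z).mp hz).tower_top

/-- `A′_j ≤ Rh`. [folklore] -/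
theorem Aj_subset_Rh (j : ℕ) {z : K} (hz : z ∈ C.Aj j) : z ∈ C.Rh := C.R_le_Rh (C.Aj_le_R j hz)

/-- `A′_j` is again an affine normalized model of `K°` over `k°`, with generators `f ∪ {u}`.
[folklore] -/
theorem isAffineNormalizedModel_Aj (j : ℕ) :
    IsAffineNormalizedModel ⊤ (baseRing K V) (C.Aj j) := by
  classical
  refine ⟨C.f ∪ Finset.univ.image (C.u j), fun _ _ => trivial, ?_, fun z => ?_⟩
  · have hCj : C.Cj j = Subring.closure ((baseRing K V : Set K) ∪
        ↑(C.f ∪ Finset.univ.image (C.u j))) := by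
      apply le_antisymm
      · refine Subring.closure_le.mpr (Set.union_subset ?_ ?_)
        · refine Subring.closure_le.mpr (Set.union_subset ?_ ?_)
          · exact fun z hz => Subring.subset_closure (Set.mem_union_left _ hz)
          · intro z hz
            exact Subring.subset_closure (Set.mem_union_right _
              (Finset.mem_coe.mpr (Finset.mem_union_left _ (Finset.mem_coe.mp hz))))
        · rintro _ ⟨i, rfl⟩
          exact Subring.subset_closure (Set.mem_union_right _ (Finset.mem_coe.mpr
            (Finset.mem_union_right _ (Finset.mem_image_of_mem _ (Finset.mem_univ i)))))
      · refine Subring.closure_le.mpr (Set.union_subset ?_ ?_)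
        · exact fun z hz => C.A₀_le_Cj j (C.baseRing_le_A₀ hz)
        · intro z hz
          rcases Finset.mem_union.mp (Finset.mem_coe.mp hz) with hz | hz
          · exact C.A₀_le_Cj j (C.f_subset_A₀ (Finset.mem_coe.mpr hz))
          · obtain ⟨i, -, rfl⟩ := Finset.mem_image.mp hz
            exact C.u_mem_Cj j i
    ext z
    rw [SetLike.mem_coe, C.mem_Aj_iff, hCj]
    rfl
  · obtain ⟨a, ha, b, hb, rfl⟩ := C.hfrac z
    exact ⟨a, C.A_le_Aj j ha, b, C.A_le_Aj j hb, rfl⟩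

/-! #### Values of zoom-model elements lie in `O` -/

/-- `ev` vanishes on the zoom coordinates: `uᵢ(x) = 0`. [folklore] -/
theorem ev_u (j : ℕ) (i : Fin C.n) : ev φ (C.u j i) = 0 := by
  have h1 : C.πK ^ j * C.u j i = C.τ i := (C.τ_eq_pow_mul_u j i).symm
  have h2 := congrArg (ev φ) h1
  rw [ev_mul φ ((Rx φ).pow_mem (C.A₀_subset_Rx C.πK_mem_A₀) _) (R_le_Rx φ (C.u_mem_R j i)),
    ev_pow φ (C.A₀_subset_Rx C.πK_mem_A₀), C.ev_πK, C.ev_τ] at h2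
  exact (mul_eq_zero.mp h2).resolve_left (pow_ne_zero _ C.π_ne_zero_m)

/-- Values of elements of `C_j` lie in `O`. [folklore] -/
theorem ev_mem_O_of_mem_Cj (j : ℕ) {z : K} (hz : z ∈ C.Cj j) : ev φ z ∈ O := by
  induction hz using Subring.closure_induction with
  | mem z hz =>
    rcases hz with hz | ⟨i, rfl⟩
    · exact ev_mem_O_of_mem_A C (C.A₀_le_A hz)
    · rw [C.ev_u]; exact zero_mem O
  | zero => rw [ev_zero φ]; exact zero_mem O
  | one => rw [ev_one φ]; exact one_mem O
  | add z w hz hw hz' hw' =>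
    rw [ev_add φ (C.Cj_subset_Rx j hz) (C.Cj_subset_Rx j hw)]; exact add_mem hz' hw'
  | neg z hz hz' =>
    have : ev φ (-z) = - ev φ z := by
      rw [neg_eq_zero_sub, ev_sub φ (Rx φ).zero_mem (C.Cj_subset_Rx j hz), ev_zero φ, zero_sub]
    rw [this]; exact neg_mem hz'
  | mul z w hz hw hz' hw' =>
    rw [ev_mul φ (C.Cj_subset_Rx j hz) (C.Cj_subset_Rx j hw)]; exact mul_mem hz' hw'

/-- **Integrality transports along `ev`**: if all coefficients of a monic relation of `z` over a
subring `S ⊆ Rh` have values in `O`, so does `z` (`O` is integrally closed in `m`). [folklore] -/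
theorem ev_mem_O_of_isIntegral {S : Subring K} (hS : ∀ z ∈ S, z ∈ (Rx φ))
    (hSO : ∀ z ∈ S, ev φ z ∈ O) {z : K} (hzRh : z ∈ (Rx φ)) (hz : IsIntegral S z) :
    ev φ z ∈ O := by
  obtain ⟨p, hp, hpz⟩ := hz
  -- push the relation through `φh`
  let evS : S →+* O := {
    toFun := fun c => ⟨ev φ c, hSO c c.2⟩
    map_one' := Subtype.ext (by simp)
    map_mul' := fun a b => Subtype.ext (by
      change ev φ ((a : K) * b) = ev φ a * ev φ b
      exact ev_mul φ (hS a a.2) (hS b b.2))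
    map_zero' := Subtype.ext (by simp)
    map_add' := fun a b => Subtype.ext (by
      change ev φ ((a : K) + b) = ev φ a + ev φ b
      exact ev_add φ (hS a a.2) (hS b b.2)) }
  have hev : ∀ c : S, (evS c : m) = ev φ c := fun c => rfl
  have key : Polynomial.eval₂ (algebraMap O m) (ev φ z) (p.map evS) = 0 := by
    rw [Polynomial.eval₂_map, Polynomial.eval₂_eq_sum_range, ← ev_zero φ, ← hpz,
      Polynomial.eval₂_eq_sum_range, ev_sum φ]
    · refine Finset.sum_congr rfl fun i _ => ?_
      change ((evS (p.coeff i) : O) : m) * ev φ z ^ i = ev φ (((p.coeff i : S) : K) * z ^ i)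
      rw [ev_mul φ (hS _ (p.coeff i).2) ((Rx φ).pow_mem hzRh i), ev_pow φ hzRh]
      rfl
    · intro i _
      exact (Rx φ).mul_mem (hS _ (p.coeff i).2) ((Rx φ).pow_mem hzRh i)
  have hint : IsIntegral O (ev φ z) := ⟨p.map evS, hp.map evS, key⟩
  obtain ⟨y, hy⟩ := IsIntegrallyClosed.algebraMap_eq_of_integral (R := O) hint
  rw [← hy]; exact y.2

/-- `A′_j ≤ Rx`. [folklore] -/
theorem Aj_subset_Rx (j : ℕ) {z : K} (hz : z ∈ C.Aj j) : z ∈ (Rx φ) := R_le_Rx φ (C.Aj_le_R j hz)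

/-- Values of elements of `A′_j` lie in `O` (`i` lifts to `i′ : Spec m° → X′`). [folklore] -/
theorem ev_mem_O_of_mem_Aj (j : ℕ) {z : K} (hz : z ∈ C.Aj j) : ev φ z ∈ O :=
  ev_mem_O_of_isIntegral (fun _ hw => C.Cj_subset_Rx j hw) (fun _ hw => C.ev_mem_O_of_mem_Cj j hw)
    (C.Aj_subset_Rx j hz) ((C.mem_Aj_iff j z).mp hz)

/-! #### `τ`-control makes elements small in the zoom rings -/

/-- **`τ`-control ⇒ `π`-divisibility in the zoom model**: if `π^e g = Σ τᵢ aᵢ` then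
`g = π^{j-e} γ` with `γ = Σ uᵢ aᵢ ∈ C_j`, for every `j ≥ e`. [folklore] -/
theorem exists_eq_pow_mul_of_tauControlled {g : K} {e : ℕ} (hg : C.TauControlled g e) {j : ℕ}
    (hj : e ≤ j) : ∃ γ ∈ C.Cj j, g = C.πK ^ (j - e) * γ := by
  obtain ⟨a, ha, hsum⟩ := hg
  refine ⟨∑ i, C.u j i * a i, Subring.sum_mem _ fun i _ =>
    Subring.mul_mem _ (C.u_mem_Cj j i) (C.A₀_le_Cj j (ha i)), ?_⟩
  have hπe : C.πK ^ e ≠ 0 := pow_ne_zero _ C.πK_ne_zero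
  apply mul_left_cancel₀ hπe
  rw [hsum, ← mul_assoc, ← pow_add, Nat.add_sub_cancel' hj, Finset.mul_sum]
  refine Finset.sum_congr rfl fun i _ => ?_
  rw [C.τ_eq_pow_mul_u j i]; ring

/-- The exponent `e_s` controlling `s(s-1)`. [folklore] -/
def es : ℕ := C.tauControlled_s_mul_s_sub_one.choose

/-- The exponent `e_h` controlling `s(h-1)`. [folklore] -/
def eh : ℕ := C.tauControlled_s_mul_h_sub_one.choose

/-- **(α) The unit `s` is integral over the zoom model**: `s ∈ A′_j` for `j ≥ e_s`, being a
root of `X² - X - π^{j-e_s}γ` with `γ ∈ C_j`. [folklore] -/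
theorem s_mem_Aj {j : ℕ} (hj : C.es ≤ j) : C.s ∈ C.Aj j := by
  obtain ⟨γ, hγ, hsγ⟩ := C.exists_eq_pow_mul_of_tauControlled
    C.tauControlled_s_mul_s_sub_one.choose_spec hj
  change C.s * (C.s - 1) = C.πK ^ (j - C.es) * γ at hsγ
  rw [C.mem_Aj_iff]
  let c₀ : C.Cj j := ⟨C.πK ^ (j - C.es) * γ, Subring.mul_mem _ (Subring.pow_mem _ (C.πK_mem_Cj j) _) hγ⟩
  -- `s` is a root of the monic `X² - (X + c₀)`
  refine ⟨X ^ (1 + 1) - (X + Polynomial.C c₀), Polynomial.monic_X_pow_sub ?_, ?_⟩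
  · have h1 : Polynomial.degree (X : (C.Cj j)[X]) ≤ 1 := Polynomial.degree_X_le
    have h2 : Polynomial.degree (Polynomial.C c₀) ≤ 1 := le_trans Polynomial.degree_C_le zero_le_one
    have h3 : ((1 : ℕ) : WithBot ℕ) < ((1 + 1 : ℕ) : WithBot ℕ) := WithBot.coe_lt_coe.mpr (by norm_num)
    exact lt_of_le_of_lt (le_trans (Polynomial.degree_add_le _ _) (max_le h1 h2)) h3
  · simp only [Polynomial.eval₂_sub, Polynomial.eval₂_add, Polynomial.eval₂_X_pow, Polynomial.eval₂_X,
      Polynomial.eval₂_C]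
    change C.s ^ (1 + 1) - (C.s + C.πK ^ (j - C.es) * γ) = 0
    rw [← hsγ]; ring

/-- `s · h ∈ A′_j` for `j ≥ max e_s e_h`: `s h = s + π^{j-e_h} γ_h`. [folklore] -/
theorem s_mul_h_mem_Aj {j : ℕ} (hjs : C.es ≤ j) (hjh : C.eh ≤ j) : C.s * C.h ∈ C.Aj j := by
  obtain ⟨γ, hγ, hsγ⟩ := C.exists_eq_pow_mul_of_tauControlled
    C.tauControlled_s_mul_h_sub_one.choose_spec hjh
  change C.s * (C.h - 1) = C.πK ^ (j - C.eh) * γ at hsγ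
  have : C.s * C.h = C.s + C.πK ^ (j - C.eh) * γ := by
    rw [← hsγ]; ring
  rw [this]
  exact Subring.add_mem _ (C.s_mem_Aj hjs)
    (C.Cj_le_Aj j (Subring.mul_mem _ (Subring.pow_mem _ (C.πK_mem_Cj j) _) hγ))

/-- `ev (s h) = 1`. [folklore] -/
theorem ev_s_mul_h : ev φ (C.s * C.h) = 1 := by
  rw [ev_mul φ (C.Rh_le_Rx C.s_mem_Rh) (R_le_Rx φ C.hhR), C.ev_s, C.ev_h, mul_one]

/-- `s ≠ 0`, `h ≠ 0`, `s h ≠ 0`, `s·(s h) ≠ 0`. [folklore] -/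
theorem s_ne_zero : C.s ≠ 0 := fun h0 => by
  have := C.ev_s; rw [h0, ev_zero φ] at this; exact zero_ne_one this

/-- The basic zoom threshold `j₀ = max e_s e_h`. [folklore] -/
def j₀ : ℕ := max C.es C.eh

/-- The denominator `d = s · (s h)` of the first localization `A″₀_j = A′_j[1/d]`. [folklore] -/
def d : K := C.s * (C.s * C.h)

/-- `d ∈ A′_j` for `j ≥ j₀`. [folklore] -/
theorem d_mem_Aj {j : ℕ} (hj : C.j₀ ≤ j) : C.d ∈ C.Aj j :=
  Subring.mul_mem _ (C.s_mem_Aj (le_trans (le_max_left _ _) hj))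
    (C.s_mul_h_mem_Aj (le_trans (le_max_left _ _) hj) (le_trans (le_max_right _ _) hj))

/-- `d ≠ 0`. [folklore] -/
theorem d_ne_zero : C.d ≠ 0 :=
  mul_ne_zero C.s_ne_zero (mul_ne_zero C.s_ne_zero C.hh0)

/-- `ev d = 1`. [folklore] -/
theorem ev_d : ev φ C.d = 1 := by
  rw [d, ev_mul φ (C.Rh_le_Rx C.s_mem_Rh) ((Rx φ).mul_mem (C.Rh_le_Rx C.s_mem_Rh) (R_le_Rx φ C.hhR)),
    C.ev_s, C.ev_s_mul_h, mul_one]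

/-- `d ∈ Rh`. [folklore] -/
theorem d_mem_Rh : C.d ∈ C.Rh := C.Rh.mul_mem C.s_mem_Rh (C.Rh.mul_mem C.s_mem_Rh (C.R_le_Rh C.hhR))

/-- **The first localized zoom ring** `A″₀_j = A′_j[1/(s·sh)] ⊆ K`: a neighbourhood of the centre
of `m°` on `X′ = Spec A′_j` on which `s` and `h` are units. [folklore] -/
def A''₀ {j : ℕ} (hj : C.j₀ ≤ j) : Subring K := awaySubring (C.Aj j) C.d (C.d_mem_Aj hj)

/-- `A′_j ≤ A″₀_j`. [folklore] -/
theorem Aj_le_A''₀ {j : ℕ} (hj : C.j₀ ≤ j) : C.Aj j ≤ C.A''₀ hj := le_awaySubring _ _ _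

/-- Membership in `A″₀_j`. [folklore] -/
theorem mem_A''₀_iff {j : ℕ} (hj : C.j₀ ≤ j) (z : K) :
    z ∈ C.A''₀ hj ↔ ∃ N : ℕ, C.d ^ N * z ∈ C.Aj j := mem_awaySubring_iff

/-- `A″₀_j ⊆ Rx` (`d` has value `1` at the point). [folklore] -/
theorem A''₀_subset_Rx {j : ℕ} (hj : C.j₀ ≤ j) {z : K} (hz : z ∈ C.A''₀ hj) : z ∈ (Rx φ) :=
  awaySubring_subset_Rx φ (fun _ hw => C.Aj_subset_Rx j hw) (C.d_mem_Aj hj)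
    (by rw [C.ev_d]; exact one_ne_zero) hz

/-- Values of elements of `A″₀_j` lie in `O`. [folklore] -/
theorem ev_mem_O_of_mem_A''₀ {j : ℕ} (hj : C.j₀ ≤ j) {z : K} (hz : z ∈ C.A''₀ hj) : ev φ z ∈ O := by
  obtain ⟨N, hN⟩ := (C.mem_A''₀_iff hj z).mp hz
  have h1 := C.ev_mem_O_of_mem_Aj j hN
  rwa [ev_mul φ ((Rx φ).pow_mem (C.Rh_le_Rx C.d_mem_Rh) N) (C.A''₀_subset_Rx hj hz),
    ev_pow φ (C.Rh_le_Rx C.d_mem_Rh), C.ev_d, one_pow, one_mul] at h1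

/-- `s ∈ A″₀_j` and `s⁻¹ ∈ A″₀_j`. [folklore] -/
theorem s_mem_A''₀ {j : ℕ} (hj : C.j₀ ≤ j) : C.s ∈ C.A''₀ hj :=
  C.Aj_le_A''₀ hj (C.s_mem_Aj (le_trans (le_max_left _ _) hj))

/-- `s⁻¹ ∈ A″₀_j`. [folklore] -/
theorem s_inv_mem_A''₀ {j : ℕ} (hj : C.j₀ ≤ j) : C.s⁻¹ ∈ C.A''₀ hj :=
  inv_mem_awaySubring_of_dvd _ (C.d_mem_Aj hj)
    (C.s_mul_h_mem_Aj (le_trans (le_max_left _ _) hj) (le_trans (le_max_right _ _) hj)) rfl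
    C.d_ne_zero

/-- `h⁻¹ ∈ A″₀_j`: `h⁻¹ = s · s · (s (s h))⁻¹ = s² d⁻¹`. [folklore] -/
theorem h_inv_mem_A''₀ {j : ℕ} (hj : C.j₀ ≤ j) : C.h⁻¹ ∈ C.A''₀ hj := by
  have : C.h⁻¹ = C.s * C.s * C.d⁻¹ := by
    rw [d]; field_simp [C.s_ne_zero, C.hh0]
  rw [this]
  exact Subring.mul_mem _ (Subring.mul_mem _ (C.s_mem_A''₀ hj) (C.s_mem_A''₀ hj))
    (inv_mem_awaySubring _ (C.d_mem_Aj hj) C.d_ne_zero)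

/-- `h ∈ A″₀_j`: `h = (s h) · s⁻¹`. [folklore] -/
theorem h_mem_A''₀ {j : ℕ} (hj : C.j₀ ≤ j) : C.h ∈ C.A''₀ hj := by
  have : C.h = (C.s * C.h) * C.s⁻¹ := by field_simp [C.s_ne_zero]
  rw [this]
  exact Subring.mul_mem _ (C.Aj_le_A''₀ hj (C.s_mul_h_mem_Aj (le_trans (le_max_left _ _) hj)
    (le_trans (le_max_right _ _) hj))) (C.s_inv_mem_A''₀ hj)

/-- `s₀ = s / h^α ∈ A″₀_j`. [folklore] -/
theorem s₀_mem_A''₀ {j : ℕ} (hj : C.j₀ ≤ j) : C.s₀ ∈ C.A''₀ hj := by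
  have : C.s₀ = C.s * (C.h⁻¹) ^ C.α := by
    rw [s, inv_pow]; field_simp [C.hh0]
  rw [this]
  exact Subring.mul_mem _ (C.s_mem_A''₀ hj) (Subring.pow_mem _ (C.h_inv_mem_A''₀ hj) _)

/-- `s₀⁻¹ = h^α / s ∈ A″₀_j`. [folklore] -/
theorem s₀_inv_mem_A''₀ {j : ℕ} (hj : C.j₀ ≤ j) : C.s₀⁻¹ ∈ C.A''₀ hj := by
  have hs₀ : C.s₀ ≠ 0 := fun h0 => by
    have := C.ev_s₀; rw [h0, ev_zero φ] at this; exact zero_ne_one this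
  have : C.s₀⁻¹ = C.h ^ C.α * C.s⁻¹ := by
    rw [s]; field_simp [C.hh0, hs₀]
  rw [this]
  exact Subring.mul_mem _ (Subring.pow_mem _ (C.h_mem_A''₀ hj) _) (C.s_inv_mem_A''₀ hj)

end DecompChart

/-! ### Smallness and inversion in the localized zoom rings -/

section EvalHom

variable {O : ValuationSubring m} {A : Subring K} (φ : Algebra.adjoin k (A : Set K) →ₐ[k] m)

/-- **Evaluation at the point as a ring homomorphism** `S → m°` on a subring `S` of the local
ring at the point whose values lie in `m°`. [folklore] -/
def evRingHom (S : Subring K) (hS : ∀ z ∈ S, z ∈ Rx φ) (hSO : ∀ z ∈ S, ev φ z ∈ O) : S →+* O where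
  toFun c := ⟨ev φ c, hSO c c.2⟩
  map_one' := Subtype.ext (by simp)
  map_mul' a b := Subtype.ext (by
    change ev φ ((a : K) * b) = ev φ a * ev φ b
    exact ev_mul φ (hS a a.2) (hS b b.2))
  map_zero' := Subtype.ext (by simp)
  map_add' a b := Subtype.ext (by
    change ev φ ((a : K) + b) = ev φ a + ev φ b
    exact ev_add φ (hS a a.2) (hS b b.2))

/-- `evRingHom` is `ev`. [folklore] -/
@[simp] theorem evRingHom_apply (S : Subring K) (hS : ∀ z ∈ S, z ∈ Rx φ)
    (hSO : ∀ z ∈ S, ev φ z ∈ O) (c : S) : (evRingHom φ S hS hSO c : m) = ev φ c := rfl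

end EvalHom

namespace DecompChart

variable {V : ValuationSubring k} {O : ValuationSubring m} {A : Subring K}
  {φ : Algebra.adjoin k (A : Set K) →ₐ[k] m} (C : DecompChart V O A φ)

/-- `c ≤ j₀`-independent facts need `j ≥ c` too; we record `j₀' = max j₀ c`. [folklore] -/
def j₀' : ℕ := max C.j₀ C.c

/-- `j₀ ≤ j₀'`. [folklore] -/
theorem j₀_le_j₀' : C.j₀ ≤ C.j₀' := le_max_left _ _

/-- `c ≤ j₀'`. [folklore] -/
theorem c_le_j₀' : C.c ≤ C.j₀' := le_max_right _ _

/-- `π ∈ A″₀_j`. [folklore] -/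
theorem πK_mem_A''₀ {j : ℕ} (hj : C.j₀ ≤ j) : C.πK ∈ C.A''₀ hj :=
  C.Aj_le_A''₀ hj (C.Cj_le_Aj j (C.πK_mem_Cj j))

/-- `A₀ ≤ A″₀_j`. [folklore] -/
theorem A₀_subset_A''₀ {j : ℕ} (hj : C.j₀ ≤ j) {z : K} (hz : z ∈ C.A₀) : z ∈ C.A''₀ hj :=
  C.Aj_le_A''₀ hj (C.Cj_le_Aj j (C.A₀_le_Cj j hz))

/-- `uᵢ ∈ A″₀_j`. [folklore] -/
theorem u_mem_A''₀ {j : ℕ} (hj : C.j₀ ≤ j) (i : Fin C.n) : C.u j i ∈ C.A''₀ hj :=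
  C.Aj_le_A''₀ hj (C.Cj_le_Aj j (C.u_mem_Cj j i))

/-- **The coordinates are small**: `Tᵢ = π^{j-c} · (uᵢ h^{-L})` in `A″₀_j`. [folklore] -/
theorem T_eq_pow_mul {j : ℕ} (hj : C.j₀ ≤ j) (hjc : C.c ≤ j) (i : Fin C.n) :
    ∃ γ ∈ C.A''₀ hj, C.T i = C.πK ^ (j - C.c) * γ := by
  refine ⟨C.u j i * (C.h⁻¹) ^ C.L, Subring.mul_mem _ (C.u_mem_A''₀ hj i)
    (Subring.pow_mem _ (C.h_inv_mem_A''₀ hj) _), ?_⟩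
  have hu : C.u j i = C.πK ^ C.c * (C.h ^ C.L * C.T i) / C.πK ^ j := rfl
  rw [hu, inv_pow]
  have hπ : C.πK ^ j = C.πK ^ (j - C.c) * C.πK ^ C.c := by
    rw [← pow_add, Nat.sub_add_cancel hjc]
  rw [hπ]
  field_simp [C.πK_ne_zero, C.hh0]

/-- **`Rh ⊆ A″₀_j[1/π]` with `j`-independent exponent**: for `z ∈ Rh` there is `b` with
`π^b z ∈ A″₀_j` for every admissible `j`. [folklore] -/
theorem exists_pow_mul_mem_A''₀ {z : K} (hz : z ∈ C.Rh) :
    ∃ b : ℕ, ∀ (j : ℕ) (hj : C.j₀ ≤ j), C.πK ^ b * z ∈ C.A''₀ hj := by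
  obtain ⟨a, b, hab⟩ := C.exists_pow_mul_pow_mul_mem_A₀ hz
  refine ⟨b, fun j hj => ?_⟩
  have : C.πK ^ b * z = C.πK ^ b * (C.h ^ a * z) * (C.h⁻¹) ^ a := by
    rw [inv_pow]; field_simp [C.hh0]
  rw [this]
  exact Subring.mul_mem _ (C.A₀_subset_A''₀ hj hab) (Subring.pow_mem _ (C.h_inv_mem_A''₀ hj) _)

/-- **Linear smallness**: an element of `Rh` vanishing at the point becomes divisible by
`π^{j-b}` in `A″₀_j`, with `b` independent of `j`: `π^b g = π^j γ`, `γ ∈ A″₀_j`. This is the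
finite-level form of "`|g| ≤ const·|π|^j` on the polydisc of radius `|π|^j` around `x̂`" for a
function `g` vanishing at `x̂` (Temkin works with the Weierstrass domain `U{r⁻¹T}`). [folklore] -/
theorem exists_small {g : K} (hg : g ∈ C.Rh) (hg0 : ev φ g = 0) :
    ∃ b : ℕ, ∀ (j : ℕ) (hj : C.j₀ ≤ j), b ≤ j → ∃ γ ∈ C.A''₀ hj, C.πK ^ b * g = C.πK ^ j * γ := by
  obtain ⟨a₀, ha₀⟩ := C.tauControlled_of_ev_eq_zero hg hg0
  obtain ⟨e, he⟩ := ha₀ a₀ le_rfl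
  refine ⟨e, fun j hj hej => ?_⟩
  obtain ⟨γ₀, hγ₀, hγ₀eq⟩ := C.exists_eq_pow_mul_of_tauControlled he hej
  -- `h^{a₀+L} s₀ g = π^{j-e} γ₀`; divide by the units `h`, `s₀` of `A″₀_j`
  have hs₀ : C.s₀ ≠ 0 := fun h0 => by
    have := C.ev_s₀; rw [h0, ev_zero φ] at this; exact zero_ne_one this
  refine ⟨γ₀ * ((C.h⁻¹) ^ (a₀ + C.L) * C.s₀⁻¹), Subring.mul_mem _ (C.Aj_le_A''₀ hj (C.Cj_le_Aj j hγ₀))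
    (Subring.mul_mem _ (Subring.pow_mem _ (C.h_inv_mem_A''₀ hj) _) (C.s₀_inv_mem_A''₀ hj)), ?_⟩
  have hπ : C.πK ^ j = C.πK ^ e * C.πK ^ (j - e) := by rw [← pow_add, Nat.add_sub_cancel' hej]
  calc C.πK ^ e * g
      = C.πK ^ e * ((C.h ^ (a₀ + C.L) * (C.s₀ * g)) * ((C.h⁻¹) ^ (a₀ + C.L) * C.s₀⁻¹)) := by
        rw [inv_pow]; field_simp [C.hh0, hs₀]
    _ = C.πK ^ j * (γ₀ * ((C.h⁻¹) ^ (a₀ + C.L) * C.s₀⁻¹)) := by rw [hγ₀eq, hπ]; ring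

/-- `π` lies in the maximal ideal of `O` (`O ∩ k = k°`, `π ∈ k°°`). [folklore] -/
theorem π_mem_maximalIdeal_O :
    (⟨algebraMap k m C.π, C.π_mem_O⟩ : O) ∈ IsLocalRing.maximalIdeal O := by
  rw [ValuationSubring.valuation_lt_one_iff]
  exact (valuation_algebraMap_lt_one_iff C.hOV C.π).mpr C.hπlt

/-- `1 - π x` is a unit of `O` for every `x ∈ O`. [folklore] -/
theorem isUnit_one_sub_π_mul (x : O) :
    IsUnit (1 - (⟨algebraMap k m C.π, C.π_mem_O⟩ : O) * x) := by
  have hmem : (⟨algebraMap k m C.π, C.π_mem_O⟩ : O) * x ∈ IsLocalRing.maximalIdeal O :=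
    Ideal.mul_mem_right _ _ C.π_mem_maximalIdeal_O
  rcases IsLocalRing.isUnit_or_isUnit_one_sub_self ((⟨algebraMap k m C.π, C.π_mem_O⟩ : O) * x)
    with hu | hu
  · exact absurd hu (mem_nonunits_iff.mp (IsLocalRing.mem_maximalIdeal _ |>.mp hmem))
  · exact hu

/-- **Inversion up to a power of `π` near the centre.** For `a ∈ R` with `a(x) ≠ 0` there are
`N`, `r ∈ R` and, in every deep enough zoom ring, an element `t` with value a UNIT of `m°` such
that `a·r = π^N·t`: so `a` divides `π^N` after inverting `t` (the finite-level form of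
"`|a| ≡ |a(x̂)| > 0` near `x̂`"). Construction: `π^N = a(x)·α′` in `O` (height one), `r` with
`r(x) = α′`, and `π^N - a r`, vanishing at `x`, is linearly small. [folklore] -/
theorem exists_mul_eq_pow_mul_unit {a : K} (ha : a ∈ Algebra.adjoin k (A : Set K))
    (ha0 : ev φ a ≠ 0) :
    ∃ (N : ℕ) (r : K), r ∈ C.A₀ ∧ ∃ b : ℕ, ∀ (j : ℕ) (hj : C.j₀ ≤ j),
      b + N + 1 ≤ j → ∃ t ∈ C.A''₀ hj, a * r = C.πK ^ N * t ∧
        ∃ ht : ev φ t ∈ O, IsUnit (⟨ev φ t, ht⟩ : O) := by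
  haveI := C.hfin
  haveI : Algebra.IsAlgebraic k m := Algebra.IsAlgebraic.of_finite k m
  obtain ⟨N₀, α', hα'O, hπN₀⟩ := exists_pow_eq_mul_of_algebraic V O C.hdim C.hπV C.hπlt C.hOV ha0
  obtain ⟨r', hr'⟩ := C.hφsurj α'
  obtain ⟨b₀, hb₀⟩ := C.hden (r' : K) r'.2
  -- the scaled preimage `r = π^{b₀} r' ∈ A₀`, exponent `N = N₀ + b₀`
  have hrR : C.πK ^ b₀ * (r' : K) ∈ Algebra.adjoin k (A : Set K) :=
    Algebra.subset_adjoin (C.A₀_le_A hb₀)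
  have hπRx : C.πK ∈ Rx φ := C.A₀_subset_Rx C.πK_mem_A₀
  have hevr : ev φ (C.πK ^ b₀ * (r' : K)) = algebraMap k m C.π ^ b₀ * α' := by
    rw [ev_mul φ ((Rx φ).pow_mem hπRx _) (R_le_Rx φ r'.2), ev_pow φ hπRx, C.ev_πK, ev_eq_φ φ r'.2,
      ← hr']
  set N := N₀ + b₀ with hN
  set g : K := C.πK ^ N - a * (C.πK ^ b₀ * r') with hg
  have hgR : g ∈ Algebra.adjoin k (A : Set K) :=
    Subalgebra.sub_mem _ (Subalgebra.pow_mem _ (Algebra.subset_adjoin (C.A₀_le_A C.πK_mem_A₀)) _)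
      (Subalgebra.mul_mem _ ha hrR)
  have hg0 : ev φ g = 0 := by
    rw [hg, ev_sub φ ((Rx φ).pow_mem hπRx N) ((Rx φ).mul_mem (R_le_Rx φ ha) (R_le_Rx φ hrR)),
      ev_pow φ hπRx, C.ev_πK, ev_mul φ (R_le_Rx φ ha) (R_le_Rx φ hrR), hevr, hN, pow_add, hπN₀]
    ring
  obtain ⟨b, hb⟩ := C.exists_small (C.R_le_Rh hgR) hg0
  refine ⟨N, C.πK ^ b₀ * r', hb₀, b, fun j hj hbj => ?_⟩
  obtain ⟨γ, hγ, hγeq⟩ := hb j hj (by omega)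
  have hγRx : γ ∈ Rx φ := C.A''₀_subset_Rx hj hγ
  -- `g = π^{j-b} γ`
  have hgeq : g = C.πK ^ (j - b) * γ := by
    apply mul_left_cancel₀ (pow_ne_zero b C.πK_ne_zero)
    rw [hγeq, ← mul_assoc, ← pow_add, Nat.add_sub_cancel' (by omega : b ≤ j)]
  -- `t = 1 - π^{j-b-N} γ`
  refine ⟨1 - C.πK ^ (j - b - N) * γ, Subring.sub_mem _ (Subring.one_mem _)
    (Subring.mul_mem _ (Subring.pow_mem _ (C.πK_mem_A''₀ hj) _) hγ), ?_, ?_⟩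
  · -- `a r = π^N - g = π^N (1 - π^{j-b-N} γ)`
    have har : a * (C.πK ^ b₀ * r') = C.πK ^ N - g := by rw [hg]; ring
    have hexp : j - b = N + (j - b - N) := by omega
    rw [har, hgeq, hexp, pow_add, Nat.add_sub_cancel_left]
    ring
  · have htRx : 1 - C.πK ^ (j - b - N) * γ ∈ Rx φ :=
      (Rx φ).sub_mem (Rx φ).one_mem ((Rx φ).mul_mem ((Rx φ).pow_mem hπRx _) hγRx)
    have hev : ev φ (1 - C.πK ^ (j - b - N) * γ) =
        1 - algebraMap k m C.π * (algebraMap k m C.π ^ (j - b - N - 1) * ev φ γ) := by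
      rw [ev_sub φ (Rx φ).one_mem ((Rx φ).mul_mem ((Rx φ).pow_mem hπRx _) hγRx), ev_one φ,
        ev_mul φ ((Rx φ).pow_mem hπRx _) hγRx, ev_pow φ hπRx, C.ev_πK, ← mul_assoc, ← pow_succ']
      congr 3
      omega
    have hγO : ev φ γ ∈ O := C.ev_mem_O_of_mem_A''₀ hj hγ
    let x : O := ⟨algebraMap k m C.π ^ (j - b - N - 1) * ev φ γ,
      mul_mem (pow_mem C.π_mem_O _) hγO⟩
    have hunit := C.isUnit_one_sub_π_mul x
    refine ⟨?_, ?_⟩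
    · rw [hev]
      exact sub_mem (one_mem O) (mul_mem C.π_mem_O x.2)
    · convert hunit using 1
      apply Subtype.ext
      exact hev

end DecompChart

end Literature.AlgebraicGeometry.Resolution
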